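import Mathlib
import HarnessLib
import Literature.MathematicalPhysics.StatisticalMechanics.RenormalisationMapKernelSubBound
import Literature.MathematicalPhysics.StatisticalMechanics.NextHamiltonianBoundsQ
import Literature.MathematicalPhysics.StatisticalMechanics.RenormalisationMapExpansion
import Literature.MathematicalPhysics.StatisticalMechanics.RGStepABKM

/-!
# `‖S_k^{(a)}(H,K) − S_k^{(b)}(H,K)‖_{k+1} ≤ Γ A^{|Λ|} (‖H̃_a − H̃_b‖_{k,0} + ℓ · max(‖H‖_{k,0}, ‖K‖_k))` —
# the renormalisation map for two step kernels, weak norm ([ABKM19] Lemma 12.6 (12.53), kernel level)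

For the torus step data `abkmStepData L R k 𝒞sa`, `abkmStepData L R k 𝒞sb` of two step-kernel families
with `StepKernelBounds` relative to the `q = 0` weights, the same `(H, K)` in the ball (`‖H‖_{k,0} ≤ 1/64`,
`‖K‖_k ≤ C ≤ 1`, `C_{8.7} C A_{𝒫,•} A⁻¹ ≤ 1/64`), and an abstract pair property `hdiff`
(`‖R_aF − R_bF‖_{k:k+1,X} ≤ b·ℓ·κ^{|X|_k}`, Lemma 8.4 with `ℓ = 1`), the difference of the two images
`K_{k+1}^{(a)} = S(H,K; 𝒞sa)` and `K_{k+1}^{(b)}` is controlled in the weak norm of scale `k+1`: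

* **`weakNormLE_nextKStep_kernel_sub_abkm`** —
  `‖nextKStep D_a H K − nextKStep D_b H K‖_{k+1}^{(A)} ≤ Γ · A^{|Λ|} · (ℓ_H + ℓ · max(‖H‖_{k,0}, C))`
  for any bound `ℓ_H` of `‖H̃_a − H̃_b‖_{k,0}` (`H̃_• = nextH D_• H K`), with the crude constant `Γ` of
  `RenormalisationMapKernelSubBound` (the large-set regulator `A^{|U|_{k+1}}` is absorbed by `A^{|Λ|}`).

Proof: `nextKStep_eq_sum` for both step data, `tayNormLE_sum_reblockTerm_kernel_sub_abkm_le` with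
`H̃ = H̃_a`, `H̃' = H̃_b`, `τ = 1/16` (`hamNorm_nextH_abkm_le_of_stepKernelBounds`).  No smallness is
claimed (Lemma 12.6 is used through Brouwer's theorem).  Everything is proved; no named fact.

## References
* S. Adams, S. Buchholz, R. Kotecký, S. Müller, arXiv:1910.13564, Lemma 12.6 (12.53), Definition 6.5
  (6.34), Ch. 9.1 [AdamsBuchholzKoteckyMuller2019].
-/

noncomputable section

namespace Literature.MathematicalPhysics.StatisticalMechanics.GradientRG

open scoped BigOperators Classical
open Finset Matrix MeasureTheory
open Literature.MathematicalPhysics.StatisticalMechanics.TorusPolymer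
  (IsPolymer blocks polys bprod blockOf thicken reblock mem_polys mem_blocks numBlocks isPolymer_blockOf
    thicken_mono thicken_mono_rad thicken_thicken subset_thicken card_blocks_eq_numBlocks boxCorner)
open Literature.Barriers.CriticalPhenomena.LongRangePhi4.Polymer (IsConn components)
open Literature.MathematicalPhysics.QuantumFieldTheory

variable {d M : ℕ} [NeZero M]

set_option maxHeartbeats 1600000 in
/-- **The renormalisation map for two step kernels, weak norm** (module docstring).
[cite: AdamsBuchholzKoteckyMuller2019, Lemma 12.6 (12.53)] -/
theorem weakNormLE_nextKStep_kernel_sub_abkm {L N Mord R n p r₀ : ℕ} {θbar lam μ δ₁ δ₀ A𝒫 A𝒫a A𝒫b C₂a C₂b h A : ℝ}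
    {𝒞 : ℕ → (Fin d → ZMod M) → ℝ} (hd : 3 ≤ d) (hLodd : Odd L) (hL : 2 ^ (d + 3) + 16 * R ≤ L)
    (hR2 : 2 ≤ R) (hM : M = L ^ N) {k : ℕ} (hkN : k + 1 ≤ N)
    {𝒞sa 𝒞sb : ℕ → (Fin d → ZMod M) → ℝ}
    (hSa : StepKernelBounds (abkmWeightData L N Mord R θbar (schedDelta δ₀ δ₁ N) 𝒞) L k A𝒫a C₂a (𝒞sa (k + 1)))
    (hSb : StepKernelBounds (abkmWeightData L N Mord R θbar (schedDelta δ₀ δ₁ N) 𝒞) L k A𝒫b C₂b (𝒞sb (k + 1)))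
    (hp : d / 2 + 1 ≤ p) (hpR : p ≤ R) (hMord : d / 2 + 1 ≤ Mord) (hr₀ : 2 ≤ r₀)
    (hB : AbkmWeightBounds L N Mord R n θbar lam μ δ₁ δ₀ A𝒫 𝒞
      (abkmWeightData L N Mord R θbar (schedDelta δ₀ δ₁ N) 𝒞))
    (hδ₀ : 0 < δ₀) (hδ₁ : 0 < δ₁) (hh : 0 < h) (hh0 : hZeroSq d R δ₀ δ₁ ≤ h ^ 2) (hA𝒫 : 0 ≤ A𝒫a)
    (hA1 : 1 ≤ A) (hh2a : C₂a ≤ h ^ 2) (hh2b : C₂b ≤ h ^ 2)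
    {H : RelevantHamiltonian ℂ d}
    (hH : hamNorm (fieldWt h (L : ℝ) d k) ((L : ℝ) ^ k) (L ^ (d * k)) H ≤ 1 / 64)
    {K : Finset (Fin d → ZMod M) → ((Fin d → ZMod M) → ℝ) → ℂ} {C : ℝ} (hC : 0 ≤ C) (hC1 : C ≤ 1)
    (hK : WeakNormLE (abkmNormParams L N Mord R p r₀ h θbar A (schedDelta δ₀ δ₁ N) 𝒞) k K C)
    (hKfac : Factorises (L ^ k) K) (hK0 : ∀ φ, K ∅ φ = 1) (hKd : ∀ Y, ContDiff ℝ r₀ (K Y))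
    (hKloc : ∀ Y, IsPolymer (L ^ k) Y → IsConn Y →
      IsGaugeLocal ((abkmNormParams L N Mord R p r₀ h θbar A (schedDelta δ₀ δ₁ N) 𝒞).gauge k Y) (K Y))
    (hva : pi2BoundConst d (((2 * R + 2 : ℕ) : ℝ) + ((d / 2 + 1 : ℕ) : ℝ)) * (C * A𝒫a * A⁻¹) ≤ 1 / 64)
    (hvb : pi2BoundConst d (((2 * R + 2 : ℕ) : ℝ) + ((d / 2 + 1 : ℕ) : ℝ)) * (C * A𝒫b * A⁻¹) ≤ 1 / 64)
    {ℓ κ : ℝ} (hℓ : 0 ≤ ℓ) (hκ : 0 ≤ κ)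
    (hdiff : ∀ X : Finset (Fin d → ZMod M), IsPolymer (L ^ k) X →
      ∀ (F : ((Fin d → ZMod M) → ℝ) → ℂ) (b : ℝ), 0 ≤ b → ContDiff ℝ r₀ F →
        IsGaugeLocal ((abkmNormParams L N Mord R p r₀ h θbar A (schedDelta δ₀ δ₁ N) 𝒞).gauge k X) F →
        TayNormLE ((abkmNormParams L N Mord R p r₀ h θbar A (schedDelta δ₀ δ₁ N) 𝒞).gauge k X) r₀
          ((abkmWeightData L N Mord R θbar (schedDelta δ₀ δ₁ N) 𝒞).weight k X) F b →
          TayNormLE ((abkmNormParams L N Mord R p r₀ h θbar A (schedDelta δ₀ δ₁ N) 𝒞).gauge k X) r₀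
            ((abkmWeightData L N Mord R θbar (schedDelta δ₀ δ₁ N) 𝒞).midWeight k X)
            (fluct (𝒞sa (k + 1)) F - fluct (𝒞sb (k + 1)) F) (b * ℓ * κ ^ numBlocks (L ^ k) X))
    {ℓH : ℝ}
    (hHt : hamNorm (fieldWt h (L : ℝ) d k) ((L : ℝ) ^ k) (L ^ (d * k))
      (nextH (abkmStepData L R k 𝒞sa) H K - nextH (abkmStepData L R k 𝒞sb) H K) ≤ ℓH) :
    WeakNormLE (abkmNormParams L N Mord R p r₀ h θbar A (schedDelta δ₀ δ₁ N) 𝒞) (k + 1)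
      (nextKStep (abkmStepData L R k 𝒞sa) H K - nextKStep (abkmStepData L R k 𝒞sb) H K)
      (((2 : ℝ) ^ Fintype.card (Fin d → ZMod M)) ^ 3 * ((10 : ℝ) ^ Fintype.card (Fin d → ZMod M)) ^ 4 *
          (144 * (Fintype.card (Fin d → ZMod M) : ℝ) * (max 1 A𝒫a) ^ Fintype.card (Fin d → ZMod M) +
            30 * (max 1 κ) ^ Fintype.card (Fin d → ZMod M)) * A ^ Fintype.card (Fin d → ZMod M) *
        (ℓH + ℓ * max (hamNorm (fieldWt h (L : ℝ) d k) ((L : ℝ) ^ k) (L ^ (d * k)) H) C)) := by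
  set P := abkmNormParams L N Mord R p r₀ h θbar A (schedDelta δ₀ δ₁ N) 𝒞 with hP
  set W := abkmWeightData L N Mord R θbar (schedDelta δ₀ δ₁ N) 𝒞 with hW
  set Da := abkmStepData L R k 𝒞sa with hDa
  set Db := abkmStepData L R k 𝒞sb with hDb
  have hd2 : 2 ≤ d := by omega
  have hL0 : (0 : ℝ) < L := by exact_mod_cast hLodd.pos
  have hA0 : 0 < A := by linarith
  have hkN' : k ≤ N := by omega
  have h𝔥 : 0 < fieldWt h (L : ℝ) d k := fieldWt_pos hh hL0 d k
  have hnn : ∀ H₀ : RelevantHamiltonian ℂ d,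
      0 ≤ hamNorm (fieldWt h (L : ℝ) d k) ((L : ℝ) ^ k) (L ^ (d * k)) H₀ := fun H₀ =>
    hamNorm_nonneg h𝔥.le (by positivity) _ H₀
  have hH8 : hamNorm (fieldWt h (L : ℝ) d k) ((L : ℝ) ^ k) (L ^ (d * k)) H ≤ 1 / 8 := hH.trans (by norm_num)
  have hH16 : hamNorm (fieldWt h (L : ℝ) d k) ((L : ℝ) ^ k) (L ^ (d * k)) H ≤ 1 / 16 := hH.trans (by norm_num)
  -- the two extracted Hamiltonians are small
  have hHta : hamNorm (fieldWt h (L : ℝ) d k) ((L : ℝ) ^ k) (L ^ (d * k)) (nextH Da H K) ≤ 1 / 16 := by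
    have h1 := hamNorm_nextH_abkm_le_of_stepKernelBounds (p := p) (r₀ := r₀) hd2 hLodd hL hM hkN hp hpR hr₀ hB hh hh2a
      hA1 Da hSa (x₀ := 0) rfl rfl H hC hK hKd hKloc
    linarith
  have hHtb : hamNorm (fieldWt h (L : ℝ) d k) ((L : ℝ) ^ k) (L ^ (d * k)) (nextH Db H K) ≤ 1 / 16 := by
    have h1 := hamNorm_nextH_abkm_le_of_stepKernelBounds (p := p) (r₀ := r₀) hd2 hLodd hL hM hkN hp hpR hr₀ hB hh hh2b
      hA1 Db hSb (x₀ := 0) rfl rfl H hC hK hKd hKloc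
    linarith
  -- constants
  set 𝔅 : ℕ := Fintype.card (Fin d → ZMod M) with h𝔅
  set Γ : ℝ := ((2 : ℝ) ^ Fintype.card (Fin d → ZMod M)) ^ 3 * ((10 : ℝ) ^ Fintype.card (Fin d → ZMod M)) ^ 4 *
          (144 * (Fintype.card (Fin d → ZMod M) : ℝ) * (max 1 A𝒫a) ^ Fintype.card (Fin d → ZMod M) +
            30 * (max 1 κ) ^ Fintype.card (Fin d → ZMod M)) with hΓ
  have hΓ0 : 0 ≤ Γ := by positivity
  set m := max (hamNorm (fieldWt h (L : ℝ) d k) ((L : ℝ) ^ k) (L ^ (d * k)) H) C with hm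
  have hm0 : 0 ≤ m := le_max_of_le_left (hnn H)
  have hℓH : 0 ≤ ℓH := (hnn _).trans hHt
  -- integrability of `P₂(Z, φ + ·)` under both step measures
  have hint : ∀ (𝒞s : ℕ → (Fin d → ZMod M) → ℝ) {A𝒫' C₂ : ℝ},
      StepKernelBounds W L k A𝒫' C₂ (𝒞s (k + 1)) → ∀ φ, ∀ Z, IsPolymer (abkmStepData L R k 𝒞s).s Z →
        Integrable (fun ξ => polyP2 (abkmStepData L R k 𝒞s).s H K Z (φ + ξ))
          (stepMeasure (abkmStepData L R k 𝒞s).𝒞) := by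
    intro 𝒞s A𝒫' C₂ hS φ Z hZ
    have hb := tayNormLE_polyP2_abkm (p := p) (r₀ := r₀) hd2 hLodd hM hkN hp hMord hB hδ₀ hδ₁ hh hh0 hA0 hZ hH8
      hC hK hKfac hK0 hKd hKloc
    have hc : 0 ≤ ∑ Y ∈ polys (L ^ k) Z, (∏ _B ∈ blocks (L ^ k) (Z \ Y),
        8 * Real.exp (1 / 4) * hamNorm (fieldWt h (L : ℝ) d k) ((L : ℝ) ^ k) (L ^ (d * k)) H) *
        ∏ Z' ∈ components Y, C * P.aFactor k Z' := by
      have := hnn H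
      exact sum_nonneg fun Y _ => mul_nonneg (prod_nonneg fun _ _ => by positivity)
        (prod_nonneg fun Z' _ => mul_nonneg hC (WeakNormLE.aFactor_pos hA0 k Z').le)
    exact integrable_comp_add_of_tayNormLE hb hc (contDiff_polyP2 (L ^ k) H hKd Z)
      (isGaugeLocal_polyP2_abkm (p := p) (r₀ := r₀) (θbar := θbar) (A := A) (δ := schedDelta δ₀ δ₁ N) (𝒞 := 𝒞)
        (N := N) (Mord := Mord) (R := R) hLodd hM hkN' hh hp H hKfac hK0 hKloc hZ)
      (hS.weightSectionDominated hB.dominated Z (P.gauge k Z)) φ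
  -- the weak norm, polymer by polymer
  intro U hU hUc
  have hU' : IsPolymer (L ^ (k + 1)) U := hU
  have hE := tayNormLE_sum_reblockTerm_kernel_sub_abkm_le (p := p) (r₀ := r₀) (A := A) hd hLodd hL hR2 hM hkN hSa hSb
    hp hMord hB hδ₀ hδ₁ hh hh0 hA𝒫 hA0 hU' hHta hHtb le_rfl hH16 hC hK hKfac hK0 hKd hKloc hℓ hκ hdiff hA1 hC1
  have hfun : (nextKStep Da H K - nextKStep Db H K) U = (fun φ => ∑ X ∈ (polys (L ^ k) univ).filter (fun X => reblock (L ^ k) (L * L ^ k) X = U),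
        ∑ X₁ ∈ polys (L ^ k) X,
        (bprod (L ^ k) (fun B => expNegH (nextH (abkmStepData L R k 𝒞sa) H K) B φ) (U \ X) * bprod (L ^ k) (fun B => expNegH (-(nextH (abkmStepData L R k 𝒞sa) H K)) B φ) (X \ U) *
            (bprod (L ^ k) (fun B => 1 - expNegH (nextH (abkmStepData L R k 𝒞sa) H K) B φ) X₁ * fluct (𝒞sa (k + 1)) (polyP2 (L ^ k) H K (X \ X₁)) φ) -
          bprod (L ^ k) (fun B => expNegH (nextH (abkmStepData L R k 𝒞sb) H K) B φ) (U \ X) * bprod (L ^ k) (fun B => expNegH (-(nextH (abkmStepData L R k 𝒞sb) H K)) B φ) (X \ U) *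
            (bprod (L ^ k) (fun B => 1 - expNegH (nextH (abkmStepData L R k 𝒞sb) H K) B φ) X₁ *
              fluct (𝒞sb (k + 1)) (polyP2 (L ^ k) H K (X \ X₁)) φ))) := by
    funext φ
    rw [Pi.sub_apply, Pi.sub_apply, nextKStep_eq_sum Da H K U φ (hint 𝒞sa hSa φ),
      nextKStep_eq_sum Db H K U φ (hint 𝒞sb hSb φ)]
    simp only [hDa, hDb, abkmStepData, Finset.sum_sub_distrib]
  rw [hfun]
  refine hE.mono ?_ (fun φ => (W.weight_pos (k + 1) U φ).le)
  -- absorb the large-set regulator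
  have hnumU : numBlocks (L ^ (k + 1)) U ≤ 𝔅 := by
    rw [← card_blocks_eq_numBlocks]; exact Finset.card_image_le.trans (Finset.card_le_univ _)
  have haF : 1 ≤ A ^ 𝔅 * P.aFactor (k + 1) U := by
    show 1 ≤ A ^ 𝔅 * (A ^ numBlocks (L ^ (k + 1)) U)⁻¹
    rw [← div_eq_mul_inv, one_le_div (pow_pos hA0 _)]
    exact pow_le_pow_right₀ hA1 hnumU
  have haF0 : 0 ≤ P.aFactor (k + 1) U := (WeakNormLE.aFactor_pos hA0 (k + 1) U).le
  have h1 : hamNorm (fieldWt h (L : ℝ) d k) ((L : ℝ) ^ k) (L ^ (d * k)) (nextH Da H K - nextH Db H K) + ℓ * m ≤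
      ℓH + ℓ * m := add_le_add hHt le_rfl
  have h2 : 0 ≤ ℓH + ℓ * m := add_nonneg hℓH (mul_nonneg hℓ hm0)
  calc Γ * (hamNorm (fieldWt h (L : ℝ) d k) ((L : ℝ) ^ k) (L ^ (d * k)) (nextH Da H K - nextH Db H K) + ℓ * m)
      ≤ Γ * (ℓH + ℓ * m) := mul_le_mul_of_nonneg_left h1 hΓ0
    _ = Γ * (ℓH + ℓ * m) * 1 := (mul_one _).symm
    _ ≤ Γ * (ℓH + ℓ * m) * (A ^ 𝔅 * P.aFactor (k + 1) U) :=
        mul_le_mul_of_nonneg_left haF (mul_nonneg hΓ0 h2)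
    _ = Γ * A ^ 𝔅 * (ℓH + ℓ * m) * P.aFactor (k + 1) U := by ring

end Literature.MathematicalPhysics.StatisticalMechanics.GradientRG

end
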